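import Literature.InformationTheory.QuantumCodes.PlanarCodeCrossingPaths
import Literature.InformationTheory.QuantumCodes.ToricCodeThreshold
import Literature.InformationTheory.QuantumCodes.PathCountingBound
import Mathlib.Analysis.SpecificLimits.Basic
import HarnessLib

/-!
# The Dennis–Kitaev–Landahl–Preskill counting bound for the PLANAR surface code: half-faulty crossing paths, their
# number `≤ (k+2)·cₙ`, and `Prob[odd-crossing residual] ≤ (k+2)·C·r^{k+2}/(1-r)` under `cₙ ≤ C νⁿ`, `r = 2ν√(p(1-p))`

Topic `Literature/InformationTheory/QuantumCodes` (venture QEC, LADDER-QEC rung Q5, PARTITION row 09; qec-type-09 gen 6,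
cell item 09.PSAW). All PROVED, kernel axioms, no named fact. Continues `PlanarCodeCrossingPaths.lean` (rough-to-rough
self-avoiding paths `(b₀, ω)` of the planar patch: `IsCrossing`, `pathQubits`, `exists_crossing_subset`) with the
probabilistic half of DKLP §5.2–5.3 in its RELATIVE form (§5.3: "we should count the 'relative polygons' that stretch from
one edge of the lattice to the opposite edge. This change has no effect on the estimate of the threshold"):

* `card_le_two_mul_card_inter_supp` — DKLP's half-weight inequality (eq. (e_ineq)) for ANY finite qubit type: if `E'` is
  minimum-weight in its syndrome class, `|E'| ≤ |E' + 𝟙_P|`, and `P ⊆ supp(E' + E)`, then `|P| ≤ 2 |P ∩ E|`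
  (type-03's `ToricCode.card_le_two_mul_card_inter`, freed from the toric types);
* ★ `exists_crossing_of_oddResidual` — if the residual `D(H_X e) + e` of a MINIMUM-WEIGHT decoder `D` crosses the bottom
  rough boundary an odd number of times (as every non-trivial logical of the sector does — one encoded qubit; the
  identification is Summits-side), some rough-to-rough self-avoiding path with `n ≥ k + 2` bonds has at least `n/2` of its
  qubits in `supp e`;
* ★ `sum_bernoulliWeight_oddResidual_le` — under independent flips of rate `0 ≤ p ≤ 1/2` and the walk-count hypothesis
  `ToricCode.SAWCountBound C ν` (`cₙ ≤ C νⁿ`, `cₙ` = number of `n`-step self-avoiding walks of `ℤ²`), with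
  `r = 2ν√(p(1-p)) < 1`: `Σ_{e : odd-crossing residual} w_p(e) ≤ Σ_{n ≥ k+2} (k+2)·cₙ·(4p̃)^{n/2} ≤ (k+2)·C·r^{k+2}/(1-r)`
  (`k + 2` bottom rough sites to start from; union bound `sum_bernoulliWeight_le_of_cover` of `PathCountingBound.lean`);
* `tendsto_sum_oddResidual` — hence for `4ν² p(1-p) < 1` these sums tend to `0` along the family `k → ∞`.

The threshold statements for the planar code (failure ⇒ odd-crossing residual by `k = 1`; `p₀(ν)`; the certified
instance `μ(ℤ²) ≤ 2.6939`) are Summits-side (`Summits/Ventures/QEC/Thresholds/PlanarSurfaceCodeSAWThresholds.lean`).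

## References

* [DennisEtAl2002] E. Dennis, A. Kitaev, A. Landahl, J. Preskill, *Topological quantum memory*, J. Math. Phys. 43 (2002)
  4452–4505, arXiv:quant-ph/0110143, §5.2 (eqs. (e_ineq), (26)–(28)), §5.3 (eqs. (29), (threshold_2d), (fail_2d); planar
  codes: relative polygons, "This change has no effect on the estimate of the threshold").
* [MadrasSlade1993] N. Madras, G. Slade, *The Self-Avoiding Walk*, Birkhäuser 1993, §1.1 (`cₙ`).
-/

namespace Literature.InformationTheory.QuantumCodes

namespace PlanarCode

open Finset Matrix Filter Topology
open Literature.Probability.LatticeModels (Site)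
open Literature.Probability.RandomPlanarGeometry
open Literature.Probability.RandomPlanarGeometry.SAW.Zd (saws card_saws)

variable {k : ℕ}

/-! ### The half-weight inequality (DKLP eq. (e_ineq)), for any check matrix -/

section HalfWeight

variable {V : Type*} [Fintype V] [DecidableEq V]

/-- If `a + b ≠ 0` in `ℤ₂` then exactly one of them vanishes. [folklore] -/
private theorem zmod2_eq_zero_iff_of_add_ne_zero {a b : ZMod 2} (h : a + b ≠ 0) : a = 0 ↔ b ≠ 0 := by
  revert a b; decide

omit [DecidableEq V] in
/-- Membership in the support. [folklore] -/
private theorem mem_supp_iff' {x : V → ZMod 2} {v : V} : v ∈ supp x ↔ x v ≠ 0 := by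
  simp [supp]

/-- **The half-weight inequality** (DKLP eq. (e_ineq)), generic in the qubit set: if `E'` is a minimum-weight chain in its
syndrome class — `|E'| ≤ |E' + 𝟙_P|` for the syndrome-free chain `𝟙_P` — and `P ⊆ supp(E' + E)`, then at least half of
the elements of `P` lie in `E` (DKLP: `H_m + H_e ≥ H` and the minimal chain has the smaller weight on the path, so
`H_e ≥ H/2`). Same argument as `ToricCode.card_le_two_mul_card_inter`, stated for any finite qubit type.
[cite: DennisEtAl2002, §5.2 eq. (e_ineq)] -/
theorem card_le_two_mul_card_inter_supp {e e' q : V → ZMod 2} {P : Finset V}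
    (hq : ∀ v, q v = if v ∈ P then 1 else 0) (hPc : P ⊆ supp (e' + e))
    (hmin : hammingNorm e' ≤ hammingNorm (e' + q)) : P.card ≤ 2 * (P ∩ supp e).card := by
  classical
  have hx_off : supp (e' + q) \ P = supp e' \ P := by
    ext v
    simp only [Finset.mem_sdiff, mem_supp_iff', Pi.add_apply]
    constructor
    · rintro ⟨h1, h2⟩
      rw [hq v, if_neg h2, add_zero] at h1
      exact ⟨h1, h2⟩
    · rintro ⟨h1, h2⟩
      rw [hq v, if_neg h2, add_zero]
      exact ⟨h1, h2⟩
  have hx_on : supp (e' + q) ∩ P = P ∩ supp e := by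
    ext v
    simp only [Finset.mem_inter, mem_supp_iff', Pi.add_apply]
    constructor
    · rintro ⟨h1, h2⟩
      refine ⟨h2, ?_⟩
      have hee : e' v + e v ≠ 0 := (mem_supp_iff' (x := e' + e)).1 (hPc h2)
      rw [hq v, if_pos h2] at h1
      have he' : e' v = 0 := by
        have : e' v + 1 ≠ 0 := h1
        revert this; generalize e' v = a; revert a; decide
      exact (zmod2_eq_zero_iff_of_add_ne_zero hee).1 he'
    · rintro ⟨h2, h1⟩
      refine ⟨?_, h2⟩
      have hee : e' v + e v ≠ 0 := (mem_supp_iff' (x := e' + e)).1 (hPc h2)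
      have he' : e' v = 0 := by
        by_contra h
        have := (zmod2_eq_zero_iff_of_add_ne_zero (by rwa [add_comm] at hee)).2 h
        exact h1 this
      rw [hq v, if_pos h2, he', zero_add]
      exact one_ne_zero
  have he'_on : supp e' ∩ P = P \ supp e := by
    ext v
    simp only [Finset.mem_inter, Finset.mem_sdiff, mem_supp_iff']
    constructor
    · rintro ⟨h1, h2⟩
      have hee : e' v + e v ≠ 0 := (mem_supp_iff' (x := e' + e)).1 (hPc h2)
      refine ⟨h2, ?_⟩
      rw [not_not]
      by_contra h
      exact h1 ((zmod2_eq_zero_iff_of_add_ne_zero hee).2 h)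
    · rintro ⟨h2, h1⟩
      have hee : e' v + e v ≠ 0 := (mem_supp_iff' (x := e' + e)).1 (hPc h2)
      rw [not_not] at h1
      refine ⟨?_, h2⟩
      intro h
      exact ((zmod2_eq_zero_iff_of_add_ne_zero hee).1 h) h1
  have h1 : (supp (e' + q)).card = (supp e' \ P).card + (P ∩ supp e).card := by
    rw [← Finset.card_sdiff_add_card_inter (supp (e' + q)) P, hx_off, hx_on]
  have h2 : (supp e').card = (supp e' \ P).card + (P \ supp e).card := by
    rw [← Finset.card_sdiff_add_card_inter (supp e') P, he'_on]
  have h3 : (P \ supp e).card + (P ∩ supp e).card = P.card := Finset.card_sdiff_add_card_inter P (supp e)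
  have hmin' : (supp e').card ≤ (supp (e' + q)).card := hmin
  omega

end HalfWeight


/-- `x + y = 0 → x = y` in `ℤ₂`. [folklore] -/
private theorem zmod2_eq_of_add_eq_zero {x y : ZMod 2} (h : x + y = 0) : x = y := by
  revert x y; decide

/-- ★ **An odd-crossing residual of a minimum-weight decoder contains a long, half-faulty rough-to-rough self-avoiding
path.** Let `D` be a minimum-weight decoder of the `H_X`-sector of the `k`-th planar surface code and `e` an error whose
residual `c = D(H_X e) + e` crosses the bottom rough boundary an odd number of times (`Σ_b c(0, b)_L = 1`; every
non-trivial logical of the sector does). Then there is a rough-to-rough self-avoiding path `(b₀, ω)` with `n ≥ k + 2`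
bonds, at least `n/2` of whose qubits lie in `supp e` (flipping `D(H_X e)` along the syndrome-free path cannot shorten it).
[cite: DennisEtAl2002, §5.2 (H ≥ L and eq. (e_ineq)), §5.3 (relative polygons of the planar code)] -/
theorem exists_crossing_of_oddResidual {D : Decoder (PlanarCheck k → ZMod 2) (PlanarQubit k → ZMod 2)}
    (hD : D.IsMinWeight (fun e => planarHX k *ᵥ e) {x | planarHX k *ᵥ x = 0} hammingNorm)
    {e : PlanarQubit k → ZMod 2} (hodd : ∑ b : Fin (k + 2), (D (planarHX k *ᵥ e) + e) (Sum.inl (0, b)) = 1) :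
    ∃ (b₀ : Fin (k + 2)) (n : ℕ) (ω : ℕ → Site 2), ω ∈ saws 2 n ∧ IsCrossing k b₀ n ω ∧ k + 2 ≤ n ∧
      n ≤ 2 * (pathQubits b₀ n ω ∩ supp e).card := by
  classical
  set e' := D (planarHX k *ᵥ e) with he'
  have hc : planarHX k *ᵥ (e' + e) = 0 := hD.add_mem e
  obtain ⟨b₀, n, ω, hω, hX, hsub⟩ :=
    exists_crossing_subset (Er := supp (e' + e)) hc (fun q hq => by simpa [supp] using hq) hodd
  refine ⟨b₀, n, ω, hω, hX, le_length_of_isCrossing hω hX, ?_⟩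
  set χ : PlanarQubit k → ZMod 2 := fun q => if q ∈ pathQubits b₀ n ω then 1 else 0 with hχ
  have hχ0 : planarHX k *ᵥ χ = 0 := planarHX_mulVec_pathQubits hω hX (χ := χ) fun q => rfl
  -- `e' + 𝟙_P` has the syndrome of `e`, so minimality of `D` compares `e'` with it
  have hsyn : planarHX k *ᵥ (e' + χ) = planarHX k *ᵥ e := by
    rw [Matrix.mulVec_add, hχ0, add_zero]
    rw [Matrix.mulVec_add] at hc
    funext i
    exact zmod2_eq_of_add_eq_zero (congrFun hc i)
  have hmin : hammingNorm e' ≤ hammingNorm (e' + χ) := by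
    have := hD.weight_le (e' + χ)
    rwa [hsyn] at this
  calc n = (pathQubits b₀ n ω).card := (card_pathQubits hω hX).symm
    _ ≤ 2 * (pathQubits b₀ n ω ∩ supp e).card := card_le_two_mul_card_inter_supp (fun q => rfl) hsub hmin


/-! ### Counting and the union bound -/

/-- A binary chain is determined by its support. [folklore] -/
private theorem supp_injective {V : Type*} [Fintype V] [DecidableEq V] :
    Function.Injective (supp : (V → ZMod 2) → Finset V) := by
  intro e₁ e₂ h
  funext v
  have h1 : v ∈ supp e₁ ↔ v ∈ supp e₂ := by rw [h]
  simp only [supp, Finset.mem_filter, Finset.mem_univ, true_and] at h1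
  have key : ∀ x y : ZMod 2, (x ≠ 0 ↔ y ≠ 0) → x = y := by decide
  exact key _ _ h1

/-- The walk-count constant is at least `1` (`c₀ = 1`), in particular non-negative. [cite: DennisEtAl2002, §5.3 eq. (29)] -/
private theorem nonneg_of_sawCountBound {C ν : ℝ} (h : ToricCode.SAWCountBound C ν) : 0 ≤ C := by
  have h0 := h 0
  rw [SAW.count_zero, pow_zero, mul_one, Nat.cast_one] at h0
  linarith

open Classical in
/-- ★ **DKLP's counting bound for the planar surface code** (relative form of eq. (fail_2d), in the tree's constants):
for a minimum-weight decoder `D` of the `H_X`-sector of the `k`-th planar code, independent flips of rate `0 ≤ p ≤ 1/2`,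
and a walk-count bound `cₙ ≤ C νⁿ` with `r = 2ν√(p(1-p)) < 1`, the total probability of the errors whose residual
`D(H_X e) + e` crosses the bottom rough boundary an odd number of times is at most
`Σ_{n=k+2}^{#qubits} (k+2)·cₙ·(2√(p(1-p)))ⁿ ≤ (k+2)·C·r^{k+2}/(1-r)`: each such error has at least half of the `n ≥ k+2`
qubits of one of the `≤ (k+2)·cₙ` rough-to-rough self-avoiding paths with `n` bonds (`exists_crossing_of_oddResidual`),
an event of probability `≤ (4p̃)^{n/2}` per path (`sum_bernoulliWeight_le_of_cover`).
[cite: DennisEtAl2002, §5.2 eqs. (27)–(28), §5.3 eqs. (29), (fail_2d)] -/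
theorem sum_bernoulliWeight_oddResidual_le {C ν : ℝ} (hν : 0 < ν) (hC : ToricCode.SAWCountBound C ν)
    {D : Decoder (PlanarCheck k → ZMod 2) (PlanarQubit k → ZMod 2)}
    (hD : D.IsMinWeight (fun e => planarHX k *ᵥ e) {x | planarHX k *ᵥ x = 0} hammingNorm)
    {p : ℝ} (hp0 : 0 ≤ p) (hp : p ≤ 1 / 2) (hr1 : 2 * ν * Real.sqrt (p * (1 - p)) < 1) :
    ∑ e ∈ univ.filter (fun e : PlanarQubit k → ZMod 2 =>
        ∑ b : Fin (k + 2), (D (planarHX k *ᵥ e) + e) (Sum.inl (0, b)) = 1), bernoulliWeight p (supp e) ≤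
      ((k : ℝ) + 2) * C * (2 * ν * Real.sqrt (p * (1 - p))) ^ (k + 2) / (1 - 2 * ν * Real.sqrt (p * (1 - p))) := by
  classical
  set s := Real.sqrt (p * (1 - p)) with hs
  set r := 2 * ν * s with hr
  have hs0 : 0 ≤ s := Real.sqrt_nonneg _
  have hr0 : 0 ≤ r := by rw [hr]; positivity
  have h1r : 0 < 1 - r := by linarith
  have hC0 : 0 ≤ C := nonneg_of_sawCountBound hC
  -- Step 1: the odd-residual error chains, reindexed by their supports
  set F := univ.filter (fun e : PlanarQubit k → ZMod 2 =>
    ∑ b : Fin (k + 2), (D (planarHX k *ᵥ e) + e) (Sum.inl (0, b)) = 1) with hF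
  have hsum : ∑ e ∈ F, bernoulliWeight p (supp e) = ∑ E ∈ F.image supp, bernoulliWeight p E :=
    (Finset.sum_image fun e₁ _ e₂ _ h => supp_injective h).symm
  rw [hsum]
  -- Step 2: the covering family — rough-to-rough self-avoiding paths graded by their number of bonds `n ∈ [k+2, #qubits]`
  set M := Fintype.card (PlanarQubit k) with hM
  set I : Finset (Σ _ : ℕ, Fin (k + 2) × (ℕ → Site 2)) :=
    (Finset.Ico (k + 2) (M + 1)).sigma fun n => (univ : Finset (Fin (k + 2))) ×ˢ saws 2 n with hI
  set Ps : Finset (Σ _ : ℕ, Fin (k + 2) × (ℕ → Site 2)) := I.filter (fun x => IsCrossing k x.2.1 x.1 x.2.2) with hPs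
  set T : (Σ _ : ℕ, Fin (k + 2) × (ℕ → Site 2)) → Finset (PlanarQubit k) :=
    fun x => pathQubits x.2.1 x.1 x.2.2 with hT
  have hmem : ∀ x ∈ Ps, x.2.2 ∈ saws 2 x.1 ∧ IsCrossing k x.2.1 x.1 x.2.2 := by
    intro x hx
    rw [hPs, Finset.mem_filter, hI, Finset.mem_sigma, Finset.mem_product] at hx
    exact ⟨hx.1.2.2, hx.2⟩
  have hcard : ∀ x ∈ Ps, (T x).card = x.1 := fun x hx => card_pathQubits (hmem x hx).1 (hmem x hx).2
  have hcover : ∀ E ∈ F.image supp, ∃ x ∈ Ps, (T x).card ≤ 2 * (T x ∩ E).card := by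
    intro E hE
    obtain ⟨e, he, rfl⟩ := Finset.mem_image.1 hE
    have hodd := (Finset.mem_filter.1 he).2
    obtain ⟨b₀, n, ω, hω, hX, hkn, hhalf⟩ := exists_crossing_of_oddResidual hD hodd
    have hnM : n ≤ M := by
      rw [← card_pathQubits hω hX]
      exact Finset.card_le_univ _
    refine ⟨⟨n, b₀, ω⟩, ?_, ?_⟩
    · rw [hPs, Finset.mem_filter, hI, Finset.mem_sigma, Finset.mem_product, Finset.mem_Ico]
      exact ⟨⟨⟨hkn, Nat.lt_succ_of_le hnM⟩, Finset.mem_univ _, hω⟩, hX⟩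
    · show (pathQubits b₀ n ω).card ≤ 2 * (pathQubits b₀ n ω ∩ supp e).card
      rw [card_pathQubits hω hX]
      exact hhalf
  have h1 := sum_bernoulliWeight_le_of_cover hp0 hp Ps T (F.image supp) hcover
  -- Step 3: `Σ_{paths} (2s)^n ≤ Σ_{n} (k+2) · cₙ · (2s)^n`
  have h2 : ∑ x ∈ Ps, (2 * s) ^ (T x).card ≤ ∑ x ∈ I, (2 * s) ^ x.1 :=
    calc ∑ x ∈ Ps, (2 * s) ^ (T x).card = ∑ x ∈ Ps, (2 * s) ^ x.1 :=
          Finset.sum_congr rfl fun x hx => by rw [hcard x hx]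
      _ ≤ ∑ x ∈ I, (2 * s) ^ x.1 :=
          Finset.sum_le_sum_of_subset_of_nonneg (Finset.filter_subset _ _) fun _ _ _ => pow_nonneg (by positivity) _
  have h3 : ∑ x ∈ I, (2 * s) ^ x.1 =
      ∑ n ∈ Finset.Ico (k + 2) (M + 1), ((k : ℝ) + 2) * ((saws 2 n).card : ℝ) * (2 * s) ^ n := by
    rw [hI, Finset.sum_sigma]
    refine Finset.sum_congr rfl fun n _ => ?_
    show ∑ y ∈ (univ : Finset (Fin (k + 2))) ×ˢ saws 2 n, (2 * s) ^ n = _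
    rw [Finset.sum_const, Finset.card_product, Finset.card_univ, Fintype.card_fin, nsmul_eq_mul]
    push_cast
    ring
  -- Step 4: `cₙ ≤ C νⁿ` and the geometric tail
  have h4 : ∀ n ∈ Finset.Ico (k + 2) (M + 1),
      ((k : ℝ) + 2) * ((saws 2 n).card : ℝ) * (2 * s) ^ n ≤ ((k : ℝ) + 2) * C * r ^ n := by
    intro n _
    have hc : ((saws 2 n).card : ℝ) ≤ C * ν ^ n := by
      rw [card_saws, SAW.Zd.count_two]
      exact hC n
    have hk : (0 : ℝ) ≤ (k : ℝ) + 2 := by positivity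
    calc ((k : ℝ) + 2) * ((saws 2 n).card : ℝ) * (2 * s) ^ n ≤ ((k : ℝ) + 2) * (C * ν ^ n) * (2 * s) ^ n :=
          mul_le_mul_of_nonneg_right (mul_le_mul_of_nonneg_left hc hk) (pow_nonneg (by positivity) _)
      _ = ((k : ℝ) + 2) * C * r ^ n := by
          rw [hr, mul_pow, mul_pow, mul_pow]
          ring
  have hgeom := geom_tail_le hr0 hr1 (k + 2) (M + 1)
  calc ∑ E ∈ F.image supp, bernoulliWeight p E
      ≤ ∑ x ∈ Ps, (2 * s) ^ (T x).card := h1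
    _ ≤ ∑ x ∈ I, (2 * s) ^ x.1 := h2
    _ = ∑ n ∈ Finset.Ico (k + 2) (M + 1), ((k : ℝ) + 2) * ((saws 2 n).card : ℝ) * (2 * s) ^ n := h3
    _ ≤ ∑ n ∈ Finset.Ico (k + 2) (M + 1), ((k : ℝ) + 2) * C * r ^ n := Finset.sum_le_sum h4
    _ = ((k : ℝ) + 2) * C * ∑ n ∈ Finset.Ico (k + 2) (M + 1), r ^ n := by rw [Finset.mul_sum]
    _ ≤ ((k : ℝ) + 2) * C * (r ^ (k + 2) / (1 - r)) := mul_le_mul_of_nonneg_left hgeom (by positivity)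
    _ = ((k : ℝ) + 2) * C * r ^ (k + 2) / (1 - r) := by ring

open Classical in
/-- **The planar counting bound tends to zero below `p₀(ν)`**: under `cₙ ≤ C νⁿ`, for every family `D k` of minimum-weight
decoders of the `H_X`-sectors of the planar surface codes and every `0 ≤ p ≤ 1/2` with `4ν² p(1-p) < 1`, the probability
of an odd-crossing residual tends to `0` as `k → ∞` ("rapidly approaches zero as L gets large": `(k+2)·r^{k+2} → 0`).
[cite: DennisEtAl2002, §5.3 eqs. (threshold_2d), (fail_2d)] -/
theorem tendsto_sum_oddResidual {C ν : ℝ} (hν : 0 < ν) (hC : ToricCode.SAWCountBound C ν)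
    (D : ∀ k, Decoder (PlanarCheck k → ZMod 2) (PlanarQubit k → ZMod 2))
    (hD : ∀ k, (D k).IsMinWeight (fun e => planarHX k *ᵥ e) {x | planarHX k *ᵥ x = 0} hammingNorm)
    {p : ℝ} (hp0 : 0 ≤ p) (hp : p ≤ 1 / 2) (h4 : 4 * ν ^ 2 * (p * (1 - p)) < 1) :
    Tendsto (fun k => ∑ e ∈ univ.filter (fun e : PlanarQubit k → ZMod 2 =>
        ∑ b : Fin (k + 2), (D k (planarHX k *ᵥ e) + e) (Sum.inl (0, b)) = 1), bernoulliWeight p (supp e))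
      atTop (𝓝 0) := by
  set s := Real.sqrt (p * (1 - p)) with hs
  set r := 2 * ν * s with hr
  have hs0 : 0 ≤ s := Real.sqrt_nonneg _
  have hr0 : 0 ≤ r := by rw [hr]; positivity
  have hpp : 0 ≤ p * (1 - p) := mul_nonneg hp0 (by linarith)
  have hr1 : r < 1 := by
    have hsq : r ^ 2 = 4 * ν ^ 2 * (p * (1 - p)) := by
      rw [hr, mul_pow, mul_pow, hs, Real.sq_sqrt hpp]
      ring
    have h : r ^ 2 < 1 := by rw [hsq]; exact h4
    have := (sq_lt_one_iff_abs_lt_one r).1 h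
    rwa [abs_of_nonneg hr0] at this
  have h1r : 0 < 1 - r := by linarith
  have hC0 : 0 ≤ C := nonneg_of_sawCountBound hC
  have hbound : ∀ k : ℕ, (∑ e ∈ univ.filter (fun e : PlanarQubit k → ZMod 2 =>
        ∑ b : Fin (k + 2), (D k (planarHX k *ᵥ e) + e) (Sum.inl (0, b)) = 1), bernoulliWeight p (supp e)) ≤
      ((k : ℝ) + 2) * C * r ^ (k + 2) / (1 - r) :=
    fun k => sum_bernoulliWeight_oddResidual_le hν hC (hD k) hp0 hp hr1
  have hnonneg : ∀ k : ℕ, 0 ≤ ∑ e ∈ univ.filter (fun e : PlanarQubit k → ZMod 2 =>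
        ∑ b : Fin (k + 2), (D k (planarHX k *ᵥ e) + e) (Sum.inl (0, b)) = 1), bernoulliWeight p (supp e) :=
    fun k => Finset.sum_nonneg fun e _ => bernoulliWeight_nonneg hp0 (by linarith) _
  -- the bound tends to zero: `(k+2) r^{k+2} → 0`
  have hlim : Tendsto (fun k : ℕ => ((k : ℝ) + 2) * C * r ^ (k + 2) / (1 - r)) atTop (𝓝 0) := by
    have h0 := tendsto_pow_const_mul_const_pow_of_abs_lt_one 1 (show |r| < 1 by rwa [abs_of_nonneg hr0])
    have h1 : Tendsto (fun k : ℕ => ((k + 2 : ℕ) : ℝ) ^ 1 * r ^ (k + 2)) atTop (𝓝 0) :=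
      (Filter.tendsto_add_atTop_iff_nat 2).2 h0
    have h2 := h1.const_mul (C / (1 - r))
    rw [mul_zero] at h2
    refine h2.congr fun k => ?_
    have h1r0 : 1 - r ≠ 0 := h1r.ne'
    push_cast
    field_simp
  refine squeeze_zero' (Filter.Eventually.of_forall hnonneg) ?_ hlim
  exact Filter.Eventually.of_forall hbound

end PlanarCode

end Literature.InformationTheory.QuantumCodes
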